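import Summits.QuantumFields.BalabanUV.Beta.EriceRemainderEnclosureHistoryRenewalBlocks

/-!
# EriceRemainderEnclosureHistoryRenewalExtremalPin — (E34c) the other side of the dichotomy: through the SAME row system, feedback
# weights SUPPORTED AT THE INFRARED PIN (the last `n₀` rows) DO give a K-uniform GEOMETRIC two-run matching rate, `θ^{(j−n₀)∕2}`
# — what decides the shape without `FadingMemory` is the TAIL of the AF weights away from the pin (abstract real sequences)

Cell `pub-balaban`, β-function sub-cell, BINDER row D4 «RemainderConst leaves for Bałaban's split» (`HOME/BINDER-OWNERS.md`; owner
lineage `b2b-balaban-beta-an4`; this file by co-owner #2 lineage `b2b-balaban-beta-d4-p2`, generation 36), β-FLOW TEAM duty (1),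
FREEZE (0) honoured (def-free; no leaf, no hypothesis shape, no β: ABSTRACT real sequences only).  Companion of (E34a)
`EriceRemainderEnclosureHistoryRenewalExtremal` (polynomially decaying, infrared-concentrated weights ⟹ NO geometric rate through the row
system) over (E33b) `EriceRemainderEnclosureHistoryRenewalBlocks` (`backward_sum_from` BY NAME).

HONEST FRAMING.  [folklore] real analysis; nothing of Bałaban's [I] is quoted, typed or asserted here; row D4 class UNCHANGED
(critical-path width 0; instance 0∕1; D4 DISCHARGE NO DATE); NOT B12 Thm 2, NOT BetaPertH, NOT continuum, NOT Clay.  HONEST DEPENDENCY: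
continuum YM on T⁴ ⇐ BetaPertH ∧ nine spine estimates (0/9 proved); BetaPertH ⇐ (D1) ∧ (D4) ∧ CAP+tail; G-an2-4 gates asym, D1 and NE2/3/4.
RELEVANCE (binding): along asymptotically free runs the AF weights `(g^A_l)²g^B_{l+1}` are NEVER supported at the pin — their value at
infrared distance `n` is `≍ (bn)^{−3∕2}` (node U2's `sum_weights_le_of_eventualLower` bounds only the SUM) — so this file is NOT a
β-level geometric rate; it isolates, inside the row system, the feature that (E34a)'s extremal solutions exploit: the polynomial tail.

THE MECHANISM.  Row system as in (E33b)∕(E34a): `δ ≥ 0`, `δ_K = 0`, `w ≥ 0`, `Σ_{l≤K} w_l ≤ U`, `q = m·U < 1`, split rows for every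
window with deletion term `2(cθ^s∕(1−θ))`, full-window rows.  If `w_l = 0` whenever `l + n₀ < K` (feedback only on the last `n₀` rows):
the bulk rows are pure source, `δ_j ≤ P + cθ^j∕(1−θ)` with `P` the largest value on the pin zone `[K−n₀, K]` (§1 `bulk_le`); a pin-zone
row `l` with the window reaching back to `i₀ = ⌊(K−n₀)∕2⌋` pays the deletion term `2cθ^{l−i₀}∕(1−θ) ≤ 2cθ^{i₀}∕(1−θ)` and sees at most
`P + cθ^{i₀}∕(1−θ)`; summing the `≤ n₀` pin-zone rows and absorbing `q·P` gives `P ≤ (3n₀+1)·cθ^{i₀}∕((1−θ)(1−q))` (§1 `pinZone_le`),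
hence `δ_j ≤ (3n₀+1)c∕((1−θ)(1−q))·θ^{⌊(K−n₀)∕2⌋} + cθ^j∕(1−θ)` (§2 `geometric_of_pinSupported`) and, K-UNIFORMLY,
`δ_j ≤ ((3n₀+1)c∕((1−θ)(1−q)) + c∕(1−θ))·θ^{⌊(j−n₀)∕2⌋}` (§2 `geometric_of_pinSupported_uniform`): rate `√θ`, constant linear in `n₀`.
Numerics (seat kit `g36/e34/num/`): the maximal solution with all weight on the last rows follows `θ^j` until the plateau `≍ θ^{K∕2}`.

WHAT IS PROVED ([folklore]; 0 `def`, 0 sorry): §1 `bulk_step`, `bulk_le`, `pinZone_le`; §2 `geometric_of_pinSupported`,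
`geometric_of_pinSupported_uniform`.
-/

noncomputable section
open Finset

namespace Summit.QuantumFields.BalabanUV.Beta.EriceRemainderEnclosureHistoryRenewalExtremalPin

open Summit.QuantumFields.BalabanUV.Beta.EriceRemainderEnclosureHistoryRenewalBlocks (backward_sum_from)

/-! ## §1 Bulk rows are pure source; the pin zone absorbs -/

/-- A row with zero weight is a pure source row: `δ_l ≤ δ_{l+1} + cθ^l` (the full-window row with the bound `B′ = Σ_{i≤l} δ_i`).
[folklore] -/
theorem bulk_step {K : ℕ} {δ w : ℕ → ℝ} {c θ m : ℝ} (hδ : ∀ i, 0 ≤ δ i)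
    (hfull : ∀ l, l < K → ∀ B' : ℝ, (∀ i, i ≤ l → δ i ≤ B') → δ l ≤ δ (l + 1) + c * θ ^ l + m * w l * B')
    {l : ℕ} (hl : l < K) (hwl : w l = 0) : δ l ≤ δ (l + 1) + c * θ ^ l := by
  have h := hfull l hl (∑ i ∈ range (l + 1), δ i)
    (fun i hi => single_le_sum (fun j _ => hδ j) (mem_range.mpr (Nat.lt_succ_of_le hi)))
  simpa [hwl] using h

/-- **THE BULK**: if `w_l = 0` for `l + n₀ < K` and `P` bounds `δ` on the pin zone `[K − n₀, K]`, then for every `j` with `j + n₀ ≤ K`: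
`δ_j ≤ P + cθ^j∕(1−θ)` (`c ≥ 0`, `0 ≤ θ < 1`). [folklore] -/
theorem bulk_le {K n₀ : ℕ} {δ w : ℕ → ℝ} {c θ m P : ℝ} (hc : 0 ≤ c) (hθ0 : 0 ≤ θ) (hθ1 : θ < 1) (hδ : ∀ i, 0 ≤ δ i)
    (hsupp : ∀ l, l + n₀ < K → w l = 0)
    (hfull : ∀ l, l < K → ∀ B' : ℝ, (∀ i, i ≤ l → δ i ≤ B') → δ l ≤ δ (l + 1) + c * θ ^ l + m * w l * B')
    (hP : ∀ i, K - n₀ ≤ i → i ≤ K → δ i ≤ P) {j : ℕ} (hj : j + n₀ ≤ K) : δ j ≤ P + c * θ ^ j / (1 - θ) := by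
  have hstep : ∀ l, j ≤ l → l < K - n₀ → (δ l - P) ≤ (δ (l + 1) - P) + c * θ ^ l := by
    intro l _ hl
    have := bulk_step hδ hfull (by omega) (hsupp l (by omega))
    linarith
  have h0 : (fun i => δ i - P) (K - n₀) ≤ 0 := by
    have := hP (K - n₀) le_rfl (Nat.sub_le _ _)
    show δ (K - n₀) - P ≤ 0
    linarith
  have h1 : δ j - P ≤ ∑ l ∈ Ico j (K - n₀), c * θ ^ l :=
    backward_sum_from (δ := fun i => δ i - P) (s := fun l => c * θ ^ l) (K := K - n₀) (J := j) h0 hstep j le_rfl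
      (by omega)
  have h2 : ∑ l ∈ Ico j (K - n₀), c * θ ^ l ≤ c * θ ^ j / (1 - θ) := by
    rw [← mul_sum, mul_div_assoc]
    exact mul_le_mul_of_nonneg_left (geom_sum_Ico_le_of_lt_one hθ0 hθ1) hc
  linarith

/-- **THE PIN ZONE ABSORBS**: with `i₀ = ⌊(K − n₀)∕2⌋`, if `w` vanishes off the last `n₀` rows, `Σ_{l≤K} w_l ≤ U`, `q = m·U < 1`, and `P`
is the LARGEST value of `δ` on `[K − n₀, K]` (attained at `i*`), then `P ≤ (3n₀ + 1)·cθ^{i₀}∕((1−θ)(1−q))` — each pin-zone row, with the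
window reaching back to `i₀`, drops by `≤ 3cθ^{i₀}∕(1−θ) + m·w_l·(P + cθ^{i₀}∕(1−θ))`. [folklore] -/
theorem pinZone_le {K n₀ : ℕ} {δ w : ℕ → ℝ} {c θ m U : ℝ} (hc : 0 ≤ c) (hθ0 : 0 ≤ θ) (hθ1 : θ < 1) (hm : 0 ≤ m)
    (hw : ∀ i, i ≤ K → 0 ≤ w i) (hU : ∑ l ∈ range (K + 1), w l ≤ U) (hq : m * U < 1)
    (hδ : ∀ i, 0 ≤ δ i) (hK : δ K = 0) (hsupp : ∀ l, l + n₀ < K → w l = 0)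
    (hrec : ∀ l, l < K → ∀ s : ℕ, ∀ B' : ℝ, (∀ i, l - s ≤ i → i ≤ l → δ i ≤ B') →
      δ l ≤ δ (l + 1) + c * θ ^ l + 2 * (c * θ ^ s / (1 - θ)) + m * w l * B')
    (hfull : ∀ l, l < K → ∀ B' : ℝ, (∀ i, i ≤ l → δ i ≤ B') → δ l ≤ δ (l + 1) + c * θ ^ l + m * w l * B')
    {istar : ℕ} (hi1 : K - n₀ ≤ istar) (hi2 : istar ≤ K) (hmax : ∀ i, K - n₀ ≤ i → i ≤ K → δ i ≤ δ istar) :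
    δ istar ≤ (3 * n₀ + 1) * (c * θ ^ ((K - n₀) / 2)) / ((1 - θ) * (1 - m * U)) := by
  set P := δ istar with hPdef
  set i₀ := (K - n₀) / 2 with hi₀
  have h1θ : 0 < 1 - θ := by linarith
  have hU0 : 0 ≤ U := (sum_nonneg fun i hi => hw i (Nat.lt_succ_iff.mp (mem_range.mp hi))).trans hU
  have hP0 : 0 ≤ P := hδ istar
  have hθi : 0 ≤ c * θ ^ i₀ := mul_nonneg hc (pow_nonneg hθ0 _)
  -- every index `i ≥ i₀` (up to `K`) carries at most `B* := P + cθ^{i₀}∕(1−θ)`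
  set Bst := P + c * θ ^ i₀ / (1 - θ) with hBst
  have hBst0 : 0 ≤ Bst := add_nonneg hP0 (div_nonneg hθi h1θ.le)
  have hall : ∀ i, i₀ ≤ i → i ≤ K → δ i ≤ Bst := by
    intro i hi hiK
    by_cases hz : K - n₀ ≤ i
    · have := hmax i hz hiK
      have : 0 ≤ c * θ ^ i₀ / (1 - θ) := div_nonneg hθi h1θ.le
      linarith
    · have hb := bulk_le (P := P) hc hθ0 hθ1 hδ hsupp hfull hmax (j := i) (by omega)
      have hθle : c * θ ^ i / (1 - θ) ≤ c * θ ^ i₀ / (1 - θ) :=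
        div_le_div_of_nonneg_right (mul_le_mul_of_nonneg_left (pow_le_pow_of_le_one hθ0 hθ1.le hi) hc) h1θ.le
      linarith
  -- the pin-zone rows
  have hrow : ∀ l, istar ≤ l → l < K → δ l ≤ δ (l + 1) + (3 * (c * θ ^ i₀) / (1 - θ) + m * w l * Bst) := by
    intro l hl hlK
    have hli : i₀ ≤ l := by omega
    have h := hrec l hlK (l - i₀) Bst (fun i hi1 hi2 => hall i (by omega) (by omega))
    have hdel : 2 * (c * θ ^ (l - i₀) / (1 - θ)) ≤ 2 * (c * θ ^ i₀ / (1 - θ)) := by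
      have : c * θ ^ (l - i₀) ≤ c * θ ^ i₀ := mul_le_mul_of_nonneg_left (pow_le_pow_of_le_one hθ0 hθ1.le (by omega)) hc
      have := div_le_div_of_nonneg_right this h1θ.le
      linarith
    have hsrc : c * θ ^ l ≤ c * θ ^ i₀ / (1 - θ) := by
      have h1 : c * θ ^ l ≤ c * θ ^ i₀ := mul_le_mul_of_nonneg_left (pow_le_pow_of_le_one hθ0 hθ1.le hli) hc
      have h2 : c * θ ^ i₀ ≤ c * θ ^ i₀ / (1 - θ) := by
        rw [le_div_iff₀ h1θ]; nlinarith
      linarith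
    have e : 3 * (c * θ ^ i₀) / (1 - θ) = c * θ ^ i₀ / (1 - θ) + 2 * (c * θ ^ i₀ / (1 - θ)) := by ring
    linarith
  -- sum them: `P ≤ n₀·3cθ^{i₀}∕(1−θ) + m·U·B*`
  have hsum := backward_sum_from (s := fun l => 3 * (c * θ ^ i₀) / (1 - θ) + m * w l * Bst) (le_of_eq hK) hrow
    istar le_rfl hi2
  have hsplit : ∑ l ∈ Ico istar K, (3 * (c * θ ^ i₀) / (1 - θ) + m * w l * Bst)
      = ((K - istar : ℕ) : ℝ) * (3 * (c * θ ^ i₀) / (1 - θ)) + m * Bst * ∑ l ∈ Ico istar K, w l := by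
    rw [sum_add_distrib, sum_const, Nat.card_Ico, nsmul_eq_mul, mul_sum]
    exact congrArg _ (sum_congr rfl fun l _ => by ring)
  have hcnt : ((K - istar : ℕ) : ℝ) ≤ n₀ := by exact_mod_cast (by omega : K - istar ≤ n₀)
  have hwsum : ∑ l ∈ Ico istar K, w l ≤ U :=
    (sum_le_sum_of_subset_of_nonneg (fun i hi => mem_range.mpr (by have := (mem_Ico.mp hi).2; omega))
      (fun i hi _ => hw i (Nat.lt_succ_iff.mp (mem_range.mp hi)))).trans hU
  have h3 : 0 ≤ 3 * (c * θ ^ i₀) / (1 - θ) := div_nonneg (by positivity) h1θ.le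
  have hPle : P ≤ n₀ * (3 * (c * θ ^ i₀) / (1 - θ)) + m * U * Bst := by
    have h4 : ((K - istar : ℕ) : ℝ) * (3 * (c * θ ^ i₀) / (1 - θ)) ≤ n₀ * (3 * (c * θ ^ i₀) / (1 - θ)) :=
      mul_le_mul_of_nonneg_right hcnt h3
    have h5 : m * Bst * ∑ l ∈ Ico istar K, w l ≤ m * Bst * U := mul_le_mul_of_nonneg_left hwsum (mul_nonneg hm hBst0)
    calc P ≤ _ := hsum
      _ = _ := hsplit
      _ ≤ n₀ * (3 * (c * θ ^ i₀) / (1 - θ)) + m * U * Bst := by linarith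
  -- absorb `q·P`
  have h1q : 0 < 1 - m * U := by linarith
  have hq0 : 0 ≤ m * U := mul_nonneg hm hU0
  rw [hBst] at hPle
  rw [le_div_iff₀ (mul_pos h1θ h1q)]
  have e1 : m * U * (P + c * θ ^ i₀ / (1 - θ)) = m * U * P + m * U * (c * θ ^ i₀ / (1 - θ)) := by ring
  rw [e1] at hPle
  have h6 : m * U * (c * θ ^ i₀ / (1 - θ)) ≤ 1 * (c * θ ^ i₀ / (1 - θ)) :=
    mul_le_mul_of_nonneg_right hq.le (div_nonneg hθi h1θ.le)
  have h7 : P * (1 - m * U) ≤ (3 * n₀ + 1) * (c * θ ^ i₀ / (1 - θ)) := by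
    have e3 : 3 * (c * θ ^ i₀) / (1 - θ) = 3 * (c * θ ^ i₀ / (1 - θ)) := by ring
    rw [e3] at hPle
    have e4 : P * (1 - m * U) = P - m * U * P := by ring
    rw [e4]
    linarith
  have e2 : (3 * n₀ + 1) * (c * θ ^ i₀ / (1 - θ)) * (1 - θ) = (3 * n₀ + 1) * (c * θ ^ i₀) := by field_simp
  calc P * ((1 - θ) * (1 - m * U)) = (P * (1 - m * U)) * (1 - θ) := by ring
    _ ≤ (3 * n₀ + 1) * (c * θ ^ i₀ / (1 - θ)) * (1 - θ) := mul_le_mul_of_nonneg_right h7 h1θ.le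
    _ = (3 * ↑n₀ + 1) * (c * θ ^ i₀) := e2

/-! ## §2 Pin-supported feedback ⟹ geometric rate `√θ` -/

/-- **PIN-SUPPORTED FEEDBACK GIVES A GEOMETRIC RATE THROUGH THE ROW SYSTEM.**  Data: `c ≥ 0`, `0 ≤ θ < 1`, `m ≥ 0`, `w ≥ 0` on `[0, K]`
with `Σ_{l≤K} w_l ≤ U`, `q = m·U < 1`, `δ ≥ 0`, `δ_K = 0`, every row `l < K` split for every window `s` (deletion term `2(cθ^s∕(1−θ))`)
and every full-window row — exactly the system of (E34a) `rowSystem_not_geometric` — and the SUPPORT condition `w_l = 0` for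
`l + n₀ < K`.  THEN for every `j ≤ K`: `δ_j ≤ (3n₀+1)·c∕((1−θ)(1−q))·θ^{⌊(K−n₀)∕2⌋} + cθ^j∕(1−θ)`.  Contrast (E34a): with weights
`U∕((K−l+1)(K−l+2))` (polynomial tail towards the ultraviolet) the same system has solutions above every geometric. [folklore] -/
theorem geometric_of_pinSupported {K n₀ : ℕ} {δ w : ℕ → ℝ} {c θ m U : ℝ} (hc : 0 ≤ c) (hθ0 : 0 ≤ θ) (hθ1 : θ < 1)
    (hm : 0 ≤ m) (hw : ∀ i, i ≤ K → 0 ≤ w i) (hU : ∑ l ∈ range (K + 1), w l ≤ U) (hq : m * U < 1)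
    (hδ : ∀ i, 0 ≤ δ i) (hK : δ K = 0) (hsupp : ∀ l, l + n₀ < K → w l = 0)
    (hrec : ∀ l, l < K → ∀ s : ℕ, ∀ B' : ℝ, (∀ i, l - s ≤ i → i ≤ l → δ i ≤ B') →
      δ l ≤ δ (l + 1) + c * θ ^ l + 2 * (c * θ ^ s / (1 - θ)) + m * w l * B')
    (hfull : ∀ l, l < K → ∀ B' : ℝ, (∀ i, i ≤ l → δ i ≤ B') → δ l ≤ δ (l + 1) + c * θ ^ l + m * w l * B') :
    ∀ j, j ≤ K → δ j ≤ (3 * n₀ + 1) * c / ((1 - θ) * (1 - m * U)) * θ ^ ((K - n₀) / 2) + c * θ ^ j / (1 - θ) := by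
  -- the largest pin-zone value
  have hne : (Icc (K - n₀) K).Nonempty := ⟨K, mem_Icc.mpr ⟨Nat.sub_le _ _, le_rfl⟩⟩
  obtain ⟨istar, histar, hmax⟩ := exists_max_image (Icc (K - n₀) K) δ hne
  rw [mem_Icc] at histar
  have hmax' : ∀ i, K - n₀ ≤ i → i ≤ K → δ i ≤ δ istar := fun i h1 h2 => hmax i (mem_Icc.mpr ⟨h1, h2⟩)
  have hP := pinZone_le hc hθ0 hθ1 hm hw hU hq hδ hK hsupp hrec hfull histar.1 histar.2 hmax'
  have h1θ : 0 < 1 - θ := by linarith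
  have e : (3 * n₀ + 1) * (c * θ ^ ((K - n₀) / 2)) / ((1 - θ) * (1 - m * U))
      = (3 * n₀ + 1) * c / ((1 - θ) * (1 - m * U)) * θ ^ ((K - n₀) / 2) := by ring
  intro j hj
  by_cases hz : j + n₀ ≤ K
  · have hb := bulk_le (P := δ istar) hc hθ0 hθ1 hδ hsupp hfull hmax' hz
    linarith
  · have h1 := hmax' j (by omega) hj
    have h2 : 0 ≤ c * θ ^ j / (1 - θ) := div_nonneg (mul_nonneg hc (pow_nonneg hθ0 _)) h1θ.le
    linarith

/-- **K-UNIFORM FORM**: under the same hypotheses, for every `j ≤ K`: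
`δ_j ≤ ((3n₀+1)·c∕((1−θ)(1−q)) + c∕(1−θ))·θ^{⌊(j−n₀)∕2⌋}` — a geometric rate `√θ` in the ultraviolet index with a constant linear in
the width `n₀` of the feedback's support at the pin, for every cutoff `K` (`⌊(K−n₀)∕2⌋ ≥ ⌊(j−n₀)∕2⌋` and `j ≥ ⌊(j−n₀)∕2⌋`). [folklore] -/
theorem geometric_of_pinSupported_uniform {K n₀ : ℕ} {δ w : ℕ → ℝ} {c θ m U : ℝ} (hc : 0 ≤ c) (hθ0 : 0 ≤ θ) (hθ1 : θ < 1)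
    (hm : 0 ≤ m) (hw : ∀ i, i ≤ K → 0 ≤ w i) (hU : ∑ l ∈ range (K + 1), w l ≤ U) (hq : m * U < 1)
    (hδ : ∀ i, 0 ≤ δ i) (hK : δ K = 0) (hsupp : ∀ l, l + n₀ < K → w l = 0)
    (hrec : ∀ l, l < K → ∀ s : ℕ, ∀ B' : ℝ, (∀ i, l - s ≤ i → i ≤ l → δ i ≤ B') →
      δ l ≤ δ (l + 1) + c * θ ^ l + 2 * (c * θ ^ s / (1 - θ)) + m * w l * B')
    (hfull : ∀ l, l < K → ∀ B' : ℝ, (∀ i, i ≤ l → δ i ≤ B') → δ l ≤ δ (l + 1) + c * θ ^ l + m * w l * B') :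
    ∀ j, j ≤ K → δ j ≤ ((3 * n₀ + 1) * c / ((1 - θ) * (1 - m * U)) + c / (1 - θ)) * θ ^ ((j - n₀) / 2) := by
  intro j hj
  have h := geometric_of_pinSupported hc hθ0 hθ1 hm hw hU hq hδ hK hsupp hrec hfull j hj
  have h1θ : 0 < 1 - θ := by linarith
  have hU0 : 0 ≤ U := (sum_nonneg fun i hi => hw i (Nat.lt_succ_iff.mp (mem_range.mp hi))).trans hU
  have h1q : 0 < 1 - m * U := by linarith
  have hA : 0 ≤ (3 * (n₀ : ℝ) + 1) * c / ((1 - θ) * (1 - m * U)) := by positivity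
  have hB : 0 ≤ c / (1 - θ) := div_nonneg hc h1θ.le
  have hp1 : θ ^ ((K - n₀) / 2) ≤ θ ^ ((j - n₀) / 2) :=
    pow_le_pow_of_le_one hθ0 hθ1.le (Nat.div_le_div_right (by omega))
  have hp2 : θ ^ j ≤ θ ^ ((j - n₀) / 2) :=
    pow_le_pow_of_le_one hθ0 hθ1.le ((Nat.div_le_self _ _).trans (Nat.sub_le _ _))
  have e : c * θ ^ j / (1 - θ) = c / (1 - θ) * θ ^ j := by ring
  rw [e] at h
  calc δ j ≤ (3 * n₀ + 1) * c / ((1 - θ) * (1 - m * U)) * θ ^ ((K - n₀) / 2) + c / (1 - θ) * θ ^ j := h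
    _ ≤ (3 * n₀ + 1) * c / ((1 - θ) * (1 - m * U)) * θ ^ ((j - n₀) / 2) + c / (1 - θ) * θ ^ ((j - n₀) / 2) :=
        add_le_add (mul_le_mul_of_nonneg_left hp1 hA) (mul_le_mul_of_nonneg_left hp2 hB)
    _ = ((3 * n₀ + 1) * c / ((1 - θ) * (1 - m * U)) + c / (1 - θ)) * θ ^ ((j - n₀) / 2) := by ring

end Summit.QuantumFields.BalabanUV.Beta.EriceRemainderEnclosureHistoryRenewalExtremalPin

end
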